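import Summits.HodgeConjecture.HodgeConjecture.Theses.CurveNetMordellWeil
import Literature.AlgebraicGeometry.HodgeTheory.HodgeClassesCupPairing
import Literature.AlgebraicGeometry.HodgeTheory.SupportedHodgeClassesAlgebraic
import Literature.AlgebraicGeometry.HodgeTheory.GysinKernelProofs
import Literature.AlgebraicGeometry.HodgeTheory.GysinFormalismPushforward
import Literature.AlgebraicGeometry.HodgeTheory.TopDegreeClasses
import Literature.AlgebraicGeometry.Resolution.ProjectiveResolutionProofs
import Literature.AlgebraicGeometry.Motives.SubschemeCycles
import Literature.AlgebraicGeometry.Motives.SegreEmbedding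
import Literature.AlgebraicGeometry.Motives.VarietiesProjectiveSpaceProofs
import Literature.AlgebraicGeometry.Motives.ComplexPointsOrientation
import Summits.HodgeConjecture.HodgeConjecture.Theorems.CurveNetMordellWeilGysinPreservesAlgebraic

/-!
# Route CurveNetMordellWeil · crux `VerticalSupportFourfolds` (stmt-HodgeConjecture-2784) — line `Sketch`:
# the crux implies vertical detection (the transfer is an EQUIVALENCE)

Companion of the registered stub `stub_detectionTransfer` (vertical detection ⇒ crux). Here the
converse: GRANTED Deligne's theorem on the kernel of restriction to a Zariski-open complement
(`Deligne1974_ker_restrictCompl_eq_iSup_range_complexGysin`, Hodge III Cor. 8.2.8, named fact of the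
tree) and the perfect pairing on Hodge classes of FOURFOLDS (`hodgeClasses_cupPairing_nondegenerate 4 X`,
BFNP (6.1), named fact), the crux `VerticalSupportFourfolds` implies VERTICAL DETECTION
(= the registered stub `stub_verticalDetection`, C⁺ of the line card `vertical-detection-contact-locus`):
on a smooth projective fourfold `X` with a surjection `pr : X ⟶ ℙ³`, a rational `(2,2)`-class `c`
that pulls back to `0` along every vertical smooth projective threefold is `0`.

So, modulo catalogued classical facts, C⁺ ⇔ crux; and (last section) crux ⇔ HC(2,2) for fourfolds
carrying a surjection onto `ℙ³`, granted the route's items `DeligneDescent`, `LefschetzOneOne`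
(`hodgeTwoTwo_le_algebraicClasses_of_verticalSupportFourfolds`, `verticalSupportFourfolds_of_hodgeTwoTwo`).
The line's open stub `stub_verticalDetection` is crux-sized by THEOREM, not by impression.

## Proof

If `c ≠ 0`, BFNP (6.1) on `X` gives a rational `(2,2)`-class `a` with `c ∪ a ≠ 0`; by the crux
`a ∈ algebraicClasses X 2 ⊔ span{vertical rational (2,2)-classes}`, and we show `c ∪ (-)` kills
both summands. A class of either kind dies off a Zariski-closed `Z ⊆ X` (of codimension `≥ 2`,
resp. `Z = pr⁻¹(T)`, `T ⊊ ℙ³` closed) whose image `pr(Z)` lies in a proper closed `T ⊆ ℙ³`;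
resolving the components of `Z` (Hironaka, the tree's theorem) and applying Deligne's theorem, it
is a sum of Gysin images `g_* y`, `g : Y ⟶ X` smooth projective of dimension `≤ 3` with
`g(Y) ⊆ Z`. By the projection formula `c ∪ g_* y = g_*(g^* c ∪ y)` (`complexGysin_cup`), and
`g^* c = 0`: for `dim Y = 3` because `g` is a vertical threefold; for `dim Y = 2` because `g`
factors through the vertical threefold `Y × ℙ¹ → Y → X` (section at a point of `ℙ¹`); smaller
dimensions do not occur in degree `4`.
-/

noncomputable section

set_option linter.dupNamespace false

open CategoryTheory MonoidalCategory CartesianMonoidalCategory AlgebraicGeometry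
open Literature.AlgebraicGeometry Literature.AlgebraicGeometry.Motives
  Literature.AlgebraicGeometry.HodgeTheory Literature.AlgebraicTopology.SingularHomology
open Summit.HodgeConjecture.HodgeConjecture.Theses.CurveNetMordellWeil (VerticalSupportFourfolds DeligneDescent
  LefschetzOneOne)

namespace Summit.HodgeConjecture.HodgeConjecture.Theorems

variable {X : Motives.SchemeOver ℂ}

/-- **A class killed by every vertical threefold is orthogonal to every Gysin image landing over a
proper closed subset of the base.** `X` smooth projective fourfold, `pr : X ⟶ ℙ³`, `c ∈ H⁴(X(ℂ); ℂ)`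
with `g^* c = 0` for every vertical smooth projective threefold `g : W ⟶ X`; then for every smooth
projective `Y` of dimension `≤ 3` and `g : Y ⟶ X` with `pr(g(Y)) ⊆ T`, `T ⊊ ℙ³` Zariski-closed, and
every `y`, `c ∪ g_* y = 0` in `H⁸(X(ℂ); ℂ)`: `c ∪ g_* y = g_*(g^* c ∪ y)` (projection formula) and
`g^* c = 0` (directly for `dim Y = 3`; through `Y × ℙ¹ → Y` for `dim Y = 2`).
[cite: FultonYoungTableaux1997, Appendix B §B.1 (6)] -/
theorem cupProduct_complexGysin_eq_zero_of_vertical (μ : OrientationFamily) (hμ : μ.HasPoincareDuality)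
    (pr : X ⟶ Motives.projectiveSpace 3 ℂ) (hX : Motives.IsSmoothProjective 4 X)
    (c : complexBetti X (2 * 2))
    (hkill : ∀ ⦃W : Motives.SchemeOver ℂ⦄, Motives.IsSmoothProjective 3 W → ∀ g : W ⟶ X,
      (∃ T : Set (Motives.projectiveSpace 3 ℂ).left, IsClosed T ∧ T ≠ Set.univ ∧
        Set.range (g ≫ pr).left.base ⊆ T) → complexBetti.map g (2 * 2) c = 0)
    {T : Set (Motives.projectiveSpace 3 ℂ).left} (hT : IsClosed T) (hTne : T ≠ Set.univ)
    {m : ℕ} {Y : Motives.SchemeOver ℂ} (hY : Motives.IsSmoothProjective m Y) (g : Y ⟶ X)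
    (hm : m ≤ 3) (hg : Set.range g.left.base ⊆ pr.left.base ⁻¹' T) {a : ℕ}
    (hab : a + 2 * 4 = 2 * 2 + 2 * m) (h448 : 2 * 2 + 2 * 2 = 2 * 4) (y : complexBetti Y a) :
    cupProduct h448 c (complexGysin μ hY hX g hab y) = 0 := by
  -- `g` composed with `pr` lands in `T`
  have hrange : Set.range (g ≫ pr).left.base ⊆ T := by
    rintro _ ⟨w, rfl⟩
    exact hg ⟨w, rfl⟩
  -- `g^* c = 0`
  have hgc : complexBetti.map g (2 * 2) c = 0 := by
    rcases Nat.lt_or_ge m 3 with hm3 | hm3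
    · -- `dim Y = 2`: factor through the vertical threefold `Y × ℙ¹`
      obtain rfl : m = 2 := by omega
      set P1 := Motives.projectiveSpace 1 ℂ with hP1def
      have hP1 : Motives.IsSmoothProjective 1 P1 := Motives.isSmoothProjective_projectiveSpace_holds ℂ 1
      have hW : Motives.IsSmoothProjective (2 + 1) (Y ⊗ P1) :=
        Motives.IsSmoothProjective.tensor_holds hY hP1
      haveI := connectedSpace_complexPoints hP1
      obtain ⟨t⟩ : Nonempty (Motives.ComplexPoints P1) := inferInstance
      have hWkill : complexBetti.map (fst Y P1 ≫ g) (2 * 2) c = 0 := by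
        refine hkill hW (fst Y P1 ≫ g) ⟨T, hT, hTne, ?_⟩
        rintro _ ⟨w, rfl⟩
        exact hrange ⟨(fst Y P1).left.base w, rfl⟩
      have hfac : g = Motives.sliceAt Y t ≫ (fst Y P1 ≫ g) := by
        rw [← Category.assoc, Motives.sliceAt_fst, Category.id_comp]
      rw [hfac, complexBetti.map_comp, CategoryTheory.comp_apply, hWkill, map_zero]
    · obtain rfl : m = 3 := by omega
      exact hkill hY g ⟨T, hT, hTne, hrange⟩
  -- projection formula
  have h := complexGysin_cup hμ hY hX g (p := 2 * 2) (q := a) (a := 2 * 2 + a) (b := 2 * 4)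
    (q' := 2 * 2) rfl (by omega) hab h448 c y
  rw [hgc, map_zero, LinearMap.zero_apply, map_zero] at h
  exact h.symm

/-- **Registered stub `stub_transferConverse` — the crux implies vertical detection** (the converse
of the line's transfer `stub_detectionTransfer`), granted Deligne's Hodge III Cor. 8.2.8 (first
hypothesis, the named fact `Deligne1974_ker_restrictCompl_eq_iSup_range_complexGysin`) and BFNP (6.1) on
fourfolds (second hypothesis, the named fact `hodgeClasses_cupPairing_nondegenerate 4 X`): if
`VerticalSupportFourfolds` holds, then on every smooth projective fourfold `X` with a surjection
`pr : X ⟶ ℙ³` a rational `(2,2)`-class killed by every vertical smooth projective threefold is zero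
— literally the statement of the registered stub `stub_verticalDetection` of line `Sketch`. With
`stub_detectionTransfer` this makes C⁺ ⇔ crux modulo catalogued classical facts.
[cite: DeligneHodgeIII1974, Cor. 8.2.8] [cite: BrosnanFangNiePearlstein2009, §6 (6.1)]
[cite: FultonYoungTableaux1997, Appendix B §B.1 (6)] -/
theorem stub_transferConverse :
    Deligne1974_ker_restrictCompl_eq_iSup_range_complexGysin →
    (∀ X : SchemeOver ℂ, hodgeClasses_cupPairing_nondegenerate 4 X) →
    Summit.HodgeConjecture.HodgeConjecture.Theses.CurveNetMordellWeil.VerticalSupportFourfolds →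
    ∀ ⦃X : Motives.SchemeOver ℂ⦄ (pr : X ⟶ Motives.projectiveSpace 3 ℂ),
      Motives.IsSmoothProjective 4 X → Function.Surjective pr.left.base →
        ∀ c : complexBetti X (2 * 2), IsRationalClass c → IsOfHodgeType 4 X (2 * 2) 2 2 c →
          (∀ ⦃W : Motives.SchemeOver ℂ⦄, Motives.IsSmoothProjective 3 W → ∀ g : W ⟶ X,
              (∃ T : Set (Motives.projectiveSpace 3 ℂ).left, IsClosed T ∧ T ≠ Set.univ ∧
                  Set.range (g ≫ pr).left.base ⊆ T) →
                complexBetti.map g (2 * 2) c = 0) →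
            c = 0 := by
  intro hA hP hCrux X pr hX hsurj c hc hH hkill
  by_contra hne
  have h448 : 2 * 2 + 2 * 2 = 2 * 4 := by norm_num
  -- a rational `(2,2)` partner `a` with `c ∪ a ≠ 0`
  obtain ⟨a, ha, haH, hca⟩ := hP X hX (2 * 4) (show 2 + 2 = 4 by norm_num) h448 c hc hH hne
  apply hca
  -- an orientation family; Hironaka; the projective space
  let μ : OrientationFamily := fun n Y hY ↦ (Motives.ComplexPoints.isOrientableOver ℂ hY).some
  have hμ : μ.HasPoincareDuality := OrientationFamily.hasPoincareDuality μ
  have hH3 : Resolution.Hironaka1964_projective.{0} := Resolution.Hironaka1964_projective_holds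
  have hP3 : Motives.IsSmoothProjective 3 (Motives.projectiveSpace 3 ℂ) :=
    Motives.isSmoothProjective_projectiveSpace_holds ℂ 3
  have hprc : IsClosedMap pr.left.base :=
    haveI := isProper_left_of_isSmoothProjective hX hP3 pr
    pr.left.isClosedMap
  -- the kernel of `c ∪ (-)`
  set K : Submodule ℂ (complexBetti X (2 * 2)) := LinearMap.ker (cupProduct h448 c) with hKdef
  -- Gysin images of a resolved family over a proper closed `T` are orthogonal to `c`
  have key : ∀ {T : Set (Motives.projectiveSpace 3 ℂ).left}, IsClosed T → T ≠ Set.univ →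
      ∀ {ι : Type} [Finite ι] {m : ι → ℕ} {Y : ι → Motives.SchemeOver ℂ}
        (hY : ∀ j, Motives.IsSmoothProjective (m j) (Y j)) (g : ∀ j, Y j ⟶ X),
        (∀ j, m j ≤ 3) → (∀ j, Set.range (g j).left.base ⊆ pr.left.base ⁻¹' T) →
        (⨆ (j : ι) (a : ℕ) (hab : a + 2 * 4 = 2 * 2 + 2 * m j),
          LinearMap.range (complexGysin μ (hY j) hX (g j) hab)) ≤ K := by
    intro T hT hTne ι _ m Y hY g hm hg
    refine iSup_le fun j ↦ iSup_le fun a ↦ iSup_le fun hab ↦ ?_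
    rintro _ ⟨y, rfl⟩
    rw [hKdef, LinearMap.mem_ker]
    exact cupProduct_complexGysin_eq_zero_of_vertical μ hμ pr hX c hkill hT hTne (hY j) (g j) (hm j)
      (hg j) hab h448 y
  -- (i) algebraic classes are orthogonal to `c`
  have hAlg : algebraicClasses X 2 ≤ K := by
    refine iSup_le fun Z ↦ iSup_le fun hZ ↦ iSup_le fun hr ↦ ?_
    obtain ⟨ι, _, m, Y, hY, g, hU, hdim⟩ := exists_family_iUnion_range_eq_of_isClosed hH3 hX hZ hr
    -- the image `pr(Z)` is a proper closed subset of `ℙ³`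
    have hTc : IsClosed (pr.left.base '' Z) := hprc _ hZ
    have hTne : pr.left.base '' Z ≠ Set.univ := by
      haveI := irreducibleSpace_of_isSmoothProjective' hP3
      intro hU'
      have hη : (genericPoint (Motives.projectiveSpace 3 ℂ).left) ∈ pr.left.base '' Z := by
        rw [hU']; exact Set.mem_univ _
      have h1 : ((1 : ℕ) : ℕ∞) ≤ Order.coheight (genericPoint (Motives.projectiveSpace 3 ℂ).left) :=
        le_coheight_of_mem_image hX hP3 pr hprc hr (by norm_num) hη
      have h0 : Order.coheight (genericPoint (Motives.projectiveSpace 3 ℂ).left) = 0 :=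
        Order.coheight_eq_zero.2 fun y _ ↦ Scheme.le_iff_specializes.2 (genericPoint_specializes y)
      rw [h0] at h1
      exact absurd h1 (by norm_num)
    have hg : ∀ j, Set.range (g j).left.base ⊆ pr.left.base ⁻¹' (pr.left.base '' Z) := by
      intro j x hx
      have hxZ : x ∈ Z := hU ▸ Set.mem_iUnion_of_mem j hx
      exact ⟨x, hxZ, rfl⟩
    rw [← hU, hA μ hμ hX hY g (2 * 2)]
    exact key hTc hTne hY g (fun j ↦ by have := hdim j; omega) (hU.symm ▸ hg)
  -- (ii) vertical rational `(2,2)`-classes are orthogonal to `c`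
  have hVert : Submodule.span ℂ {v : complexBetti X (2 * 2) |
      IsRationalClass v ∧ IsOfHodgeType 4 X (2 * 2) 2 2 v ∧
        ∃ T : Set (Motives.projectiveSpace 3 ℂ).left, IsClosed T ∧ T ≠ Set.univ ∧
          complexBetti.restrictCompl X (pr.left.base ⁻¹' T) (2 * 2) v = 0} ≤ K := by
    refine Submodule.span_le.2 ?_
    rintro v ⟨-, -, T, hT, hTne, hv0⟩
    have hZ : IsClosed (pr.left.base ⁻¹' T) := hT.preimage pr.left.base.hom.continuous
    have hZne : pr.left.base ⁻¹' T ≠ Set.univ := by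
      intro hU
      apply hTne
      refine Set.eq_univ_of_forall fun t ↦ ?_
      obtain ⟨x, rfl⟩ := hsurj t
      have hx : x ∈ pr.left.base ⁻¹' T := by rw [hU]; exact Set.mem_univ x
      exact hx
    have hr : ∀ z ∈ pr.left.base ⁻¹' T, ((1 : ℕ) : ℕ∞) ≤ Order.coheight z :=
      fun z hz ↦ one_le_coheight_of_mem_of_isClosed hX hZ hZne hz
    obtain ⟨ι, _, m, Y, hY, g, hU, hdim⟩ := exists_family_iUnion_range_eq_of_isClosed hH3 hX hZ hr
    have hg : ∀ j, Set.range (g j).left.base ⊆ pr.left.base ⁻¹' T := by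
      intro j x hx
      exact hU ▸ Set.mem_iUnion_of_mem j hx
    have hvker : v ∈ LinearMap.ker (complexBetti.restrictCompl X (⋃ j, Set.range (g j).left.base)
        (2 * 2)).hom := by
      rw [LinearMap.mem_ker, hU]
      exact hv0
    rw [hA μ hμ hX hY g (2 * 2)] at hvker
    exact key hT hTne hY g (fun j ↦ by have := hdim j; omega) hg hvker
  -- conclusion: `a ∈ Alg ⊔ Vert ≤ K`
  have haK : a ∈ K := sup_le hAlg hVert (hCrux pr hX hsurj (Submodule.subset_span ⟨ha, haH⟩))
  rw [hKdef, LinearMap.mem_ker] at haK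
  exact haK

/-! ### The crux is the Hodge conjecture for `(2,2)`-classes on fourfolds with a surjection onto `ℙ³` -/

/-- **`VerticalSupportFourfolds` ⇒ HC(2,2) on every smooth projective fourfold carrying a surjection
onto `ℙ³`**, granted the route's support items `DeligneDescent` (one descent step: a rational
`(2,2)`-class dying off `pr⁻¹(T)` is a sum of Gysin images of rational `(1,1)`- and `(0,0)`-classes)
and `LefschetzOneOne` (those are algebraic); Gysin images of algebraic classes are algebraic by the
route's PROVED item `GysinPreservesAlgebraic`. (The `q = 2`, `n = 4` slice of the `vert` step of the
route's deciding theorem `closes`; the converse inclusion is `le_sup_left`.)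
[cite: DeligneHodgeIII1974, Cor. 8.2.8] [cite: VoisinHodgeI2002, Thm. 11.30] -/
theorem hodgeTwoTwo_le_algebraicClasses_of_verticalSupportFourfolds (hDesc : DeligneDescent)
    (hL11 : LefschetzOneOne) (hCrux : VerticalSupportFourfolds)
    ⦃X : Motives.SchemeOver ℂ⦄ (pr : X ⟶ Motives.projectiveSpace 3 ℂ)
    (hX : Motives.IsSmoothProjective 4 X) (hsurj : Function.Surjective pr.left.base) :
    Submodule.span ℂ {c : complexBetti X (2 * 2) |
        IsRationalClass c ∧ IsOfHodgeType 4 X (2 * 2) 2 2 c} ≤ algebraicClasses X 2 := by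
  let μ : OrientationFamily := fun n Y hY ↦ (Motives.ComplexPoints.isOrientableOver ℂ hY).some
  have hμ : μ.HasPoincareDuality := OrientationFamily.hasPoincareDuality μ
  have hGys := curveNetMordellWeil_gysinPreservesAlgebraic_proof
  refine (hCrux pr hX hsurj).trans (sup_le le_rfl (Submodule.span_le.2 ?_))
  rintro c ⟨hc, hh, T, hT, hTne, hcT⟩
  have hY : IsClosed (pr.left.base ⁻¹' T) := hT.preimage pr.left.base.hom.continuous
  have hYne : pr.left.base ⁻¹' T ≠ Set.univ := by
    intro hU
    apply hTne
    refine Set.eq_univ_of_forall fun t ↦ ?_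
    obtain ⟨x, rfl⟩ := hsurj t
    have hx : x ∈ pr.left.base ⁻¹' T := by rw [hU]; exact Set.mem_univ x
    exact hx
  have hmem := hDesc μ hμ (n := 4) (q := 2) hX (pr.left.base ⁻¹' T) hY hYne c hc hh hcT
  have aux : ∀ S : Submodule ℂ (complexBetti X (2 * 2)), c ∈ S → S ≤ algebraicClasses X 2 →
      c ∈ algebraicClasses X 2 := fun S h₁ h₂ ↦ h₂ h₁
  refine aux _ hmem ?_
  refine iSup_le fun d ↦ iSup_le fun e ↦ iSup_le fun hde ↦ iSup_le fun he ↦ iSup_le fun W ↦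
    iSup_le fun m' ↦ iSup_le fun hm ↦ iSup_le fun hW ↦ iSup_le fun g ↦ ?_
  -- `d < 2`: the lifted classes are algebraic (`d = 0`: everything; `d = 1`: Lefschetz (1,1))
  rcases Nat.lt_or_ge d 1 with hd0 | hd1
  · obtain rfl : d = 0 := by omega
    obtain rfl : e = 2 := by omega
    have hd : Submodule.span ℂ {b : complexBetti W (2 * 0) |
        IsRationalClass b ∧ IsOfHodgeType m' W (2 * 0) 0 0 b} ≤ algebraicClasses W 0 := by
      rw [algebraicClasses_zero]
      exact le_top
    exact (Submodule.map_mono hd).trans (hGys μ hμ hW hX g hm)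
  · obtain rfl : d = 1 := by omega
    obtain rfl : e = 1 := by omega
    have hd : Submodule.span ℂ {b : complexBetti W (2 * 1) |
        IsRationalClass b ∧ IsOfHodgeType m' W (2 * 1) 1 1 b} ≤ algebraicClasses W 1 :=
      Submodule.span_le.2 fun b hb ↦ hL11 hW b hb.1 hb.2
    exact (Submodule.map_mono hd).trans (hGys μ hμ hW hX g hm)

/-- **Conversely (trivially), HC(2,2) on `X` implies the crux's conclusion for every `pr`**: the
algebraic classes form the first summand of its right-hand side. [folklore] -/
theorem verticalSupportFourfolds_of_hodgeTwoTwo ⦃X : Motives.SchemeOver ℂ⦄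
    (pr : X ⟶ Motives.projectiveSpace 3 ℂ)
    (h : Submodule.span ℂ {c : complexBetti X (2 * 2) |
        IsRationalClass c ∧ IsOfHodgeType 4 X (2 * 2) 2 2 c} ≤ algebraicClasses X 2) :
    Submodule.span ℂ {c : complexBetti X (2 * 2) |
        IsRationalClass c ∧ IsOfHodgeType 4 X (2 * 2) 2 2 c} ≤
      algebraicClasses X 2 ⊔ Submodule.span ℂ {c : complexBetti X (2 * 2) |
        IsRationalClass c ∧ IsOfHodgeType 4 X (2 * 2) 2 2 c ∧
          ∃ T : Set (Motives.projectiveSpace 3 ℂ).left, IsClosed T ∧ T ≠ Set.univ ∧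
            complexBetti.restrictCompl X (pr.left.base ⁻¹' T) (2 * 2) c = 0} :=
  h.trans le_sup_left

/-- **Sanity / refuter-facing corollary: the open stub `stub_verticalDetection` is implied by the
Hodge conjecture** (modulo the same two classical named facts): `HodgeConjecture` gives HC(2,2) on
every smooth projective fourfold, hence `VerticalSupportFourfolds` (`verticalSupportFourfolds_of_hodgeTwoTwo`),
hence vertical detection (`stub_transferConverse`). So a refutation of the stub would refute the Hodge
conjecture granted Deligne's Cor. 8.2.8 and BFNP (6.1). [cite: Deligne2000, §1]
[cite: BrosnanFangNiePearlstein2009, §6 (6.1)] -/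
theorem verticalDetection_of_hodgeConjecture
    (hA : Deligne1974_ker_restrictCompl_eq_iSup_range_complexGysin)
    (hP : ∀ X : SchemeOver ℂ, hodgeClasses_cupPairing_nondegenerate 4 X)
    (hHC : _root_.HodgeConjecture) :
    ∀ ⦃X : Motives.SchemeOver ℂ⦄ (pr : X ⟶ Motives.projectiveSpace 3 ℂ),
      Motives.IsSmoothProjective 4 X → Function.Surjective pr.left.base →
        ∀ c : complexBetti X (2 * 2), IsRationalClass c → IsOfHodgeType 4 X (2 * 2) 2 2 c →
          (∀ ⦃W : Motives.SchemeOver ℂ⦄, Motives.IsSmoothProjective 3 W → ∀ g : W ⟶ X,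
              (∃ T : Set (Motives.projectiveSpace 3 ℂ).left, IsClosed T ∧ T ≠ Set.univ ∧
                  Set.range (g ≫ pr).left.base ⊆ T) →
                complexBetti.map g (2 * 2) c = 0) →
            c = 0 :=
  stub_transferConverse hA hP fun _ pr hX _ ↦
    verticalSupportFourfolds_of_hodgeTwoTwo pr
      (Submodule.span_le.2 fun c hc ↦ (hHC hX).2 2 c hc.1 hc.2)

end Summit.HodgeConjecture.HodgeConjecture.Theorems

end
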